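import Summits.CriticalPhenomena.CardyFormulaZ2.Theorems.CardyBoundaryCoulombGasBoundaryDefectGaussianRStubRealisabilityPart38
import Literature.Probability.Percolation.FKLoopWindingCells

/-!
# Stub `s17_strandTurning` of line `rainbow-monomials-in-excursion-kernels` — Part 5:
# tracked cuts sit at rim points of the cell region
# (crux `BoundaryDefectGaussianR`, stmt-CriticalPhenomena-14132; insertion dictionary D2, T6)

The local geometric input of T6. For an ADMISSIBLE leg insertion `ι` on `V` with FLAT insertion
points (radius `sinkLegs + 3`) and local CHARTS at the boundary vertices (hypotheses of
`tc_trackedCuts_are_ends`, Part 38), every TRACKED CUT corner `b` of the jump collar `ι.model V`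
(`CollarLegModel.IsCut`) has a frozen CLOSED target (open targets are consistent turns,
`tc_turnConsistent_of_open`, Part 37), so its successor is `(b.1, b.2 + 1)` whatever the live edges,
and the medial point at the head of its dart is a RIM point of the cell region: it carries the dart
of an UNTRACKED corner one of whose sides is a cell (`s17_strandTurning_part5`, registered). Indeed
`b` is a registered strand end (Part 38) created at an active rail dart `(c, K)` of the collar walk
(Part 21 `se_active_rail`); a tracked cut is either the finish `(c, K + 3)` of a JUMP — then
`c + dir K` is neither in `V` (rail chart) nor a ghost (both stretches at a jump are free,
`tc_railGhost_wired`, Part 36), and the corner `(c + dir K, K + 2)`, whose face is the collar face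
before the dart, is untracked with the same medial position as the successor `(c, K)` — or the end
`(c + dir K, K + 2)` of a junction OPENING the arc — then the successor `(c + dir K, K + 3)` itself is
untracked (outer face, `se_ghost_outer_faces`, Part 26) at the ghost `c + dir K`; the other two end
types have live or open targets. Everything is proved; no new definitions.
-/

namespace Summit.CriticalPhenomena.CardyFormulaZ2.Cruxes.BoundaryDefectGaussianR.RainbowMonomialsInExcursionKernels

open Literature.Probability.LatticeModels Literature.Probability.LatticeModels.CollarLegModel
open Literature.Probability.Percolation

/-- The corner `(v + e_K, K + 2)` starts at the same medial point as the corner `(v, K)` (both sit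
on the edge `{v, v + e_K}`). [folklore] -/
theorem s17_st5_cpos_add (v : Site 2) (K : Fin 4) : cpos (v + cornerUnit K, K + 2) = cpos (v, K) := by
  fin_cases K <;> simp [cpos, cposOff, cornerUnit] <;> omega

/-- `Fin 4` bookkeeping. [folklore] -/
theorem s17_st5_fin4 (K : Fin 4) : K + 3 + 1 = K ∧ K + 2 + 1 = K + 3 ∧ K + 1 + 1 = K + 2 := by
  revert K; decide

/-- **Registered sub-goal `s17_strandTurning_part5`: tracked cuts sit at rim points.** For an
admissible leg insertion with FLAT insertion points (radius `sinkLegs + 3`) and local CHARTS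
(radius `3`) at the boundary vertices, every tracked cut corner `b` of the jump collar has a closed
target in the completed configuration of no live edge, its successor there is `(b.1, b.2 + 1)`, and
some UNTRACKED corner `q` with a cell on one side of its dart (its vertex a vertex-cell or its face a
face-cell) starts at the medial position of that successor. [folklore] -/
theorem s17_strandTurning_part5 : ∀ (ι : Literature.Probability.LatticeModels.CollarLegModel.LegInsertionData) (V : Finset (ℤ × ℤ)), ι.IsAdmissible V → (∀ x ∈ insert ι.sink ι.source, ∃ dvec : ℤ × ℤ, (dvec = (1, 0) ∨ dvec = (-1, 0) ∨ dvec = (0, 1) ∨ dvec = (0, -1)) ∧ ∀ v : ℤ × ℤ, (v.1 - x.1) ^ 2 + (v.2 - x.2) ^ 2 ≤ ((ι.sinkLegs : ℤ) + 3) ^ 2 → (v ∈ V ↔ 0 ≤ (v.1 - x.1) * dvec.1 + (v.2 - x.2) * dvec.2)) → (∀ u ∈ V, ∀ k : Fin 4, u + Literature.Probability.LatticeModels.CollarLegModel.dir k ∉ V → ∃ (K : Fin 4) (c₁ c₂ : ℤ), (∀ v : ℤ × ℤ, |v.1 - u.1| ≤ 3 → |v.2 - u.2| ≤ 3 → (v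 ∈ V ↔ c₂ ≤ v.1 * (Literature.Probability.LatticeModels.CollarLegModel.dir (K + 1)).1 + v.2 * (Literature.Probability.LatticeModels.CollarLegModel.dir (K + 1)).2)) ∨ (∀ v : ℤ × ℤ, |v.1 - u.1| ≤ 3 → |v.2 - u.2| ≤ 3 → (v ∈ V ↔ c₁ ≤ v.1 * (Literature.Probability.LatticeModels.CollarLegModel.dir K).1 + v.2 * (Literature.Probability.LatticeModels.CollarLegModel.dir K).2 ∧ c₂ ≤ v.1 * (Literature.Probability.LatticeModels.CollarLegModel.dir (K + 1)).1 + v.2 * (Literature.Probability.LatticeModels.CollarLegModel.dir (K + 1)).2)) ∨ (∀ v : ℤ × ℤ, |v.1 - u.1| ≤ 3 → |v.2 - u.2| ≤ 3 → (v ∈ V ↔ c₂ ≤ v.1 * (Literature.Probability.LatticeModels.CollarLegModel.dir (K + 1)).1 + v.2 * (Literature.Probability.LatticeModels.CollarLegModel.dir (K + 1)).2 ∨ v.1 * (Literature.Probability.LatticeModels.CollarLegModel.dir K).1 + v.2 * (Literature.Probability.LatticeModels.CollarLegModel.dir K).2 ≤ c₁))) → ∀ (b : Literature.Probability.LatticeModels.Site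 2 × Fin 4), (ι.model V).IsTracked b → (ι.model V).IsCut b → Literature.Probability.LatticeModels.cTgt b ∉ (ι.model V).cfgOf ∅ ∧ Literature.Probability.LatticeModels.nextCorner ((ι.model V).cfgOf ∅) b = (b.1, b.2 + 1) ∧ ∃ q : Literature.Probability.LatticeModels.Site 2 × Fin 4, ¬(ι.model V).IsTracked q ∧ (Literature.Probability.LatticeModels.CollarLegModel.ofSite q.1 ∈ (ι.model V).vertexCells ∨ Literature.Probability.LatticeModels.CollarLegModel.ofSite (Literature.Probability.LatticeModels.cFace q) ∈ (ι.model V).faceCells) ∧ Literature.Probability.LatticeModels.cpos q = Literature.Probability.LatticeModels.cpos (Literature.Probability.LatticeModels.nextCorner ((ι.model V).cfgOf ∅) b) := by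
  intro ι V hadm hflat hchart b htr hcut
  have hcl : cTgt b ∉ (ι.model V).cfgOf ∅ := fun hm =>
    hcut.2 (tc_turnConsistent_of_open ι V hadm hflat hchart htr hm)
  refine ⟨hcl, nextCorner_of_not_mem hcl, ?_⟩
  rw [nextCorner_of_not_mem hcl]
  -- `b` is a strand end, created at an active rail dart `(c, K)` of the collar walk
  obtain ⟨m, hm⟩ := tc_trackedCuts_are_ends ι V hadm hflat hchart b htr hcut
  obtain ⟨d₀, h, -⟩ := s3_of_admissible ι V hadm
  set st : ℕ → WalkState := fun t => List.foldl (fun s d => s.step (ι.startAt V d)) ι.init ((cycle V d₀).take t)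
    with hst_def
  have hst : ∀ t, st t = List.foldl (fun s d => s.step (ι.startAt V d)) ι.init ((cycle V d₀).take t) :=
    fun _ => rfl
  obtain ⟨t, ht, hend⟩ := (se_mem_strandEnds_iff ι V h hst).1 hm
  have hact : (st (t + 1)).level ≠ (st t).level := fun h0 => by
    rw [se_endsAt_nil _ _ _ h0] at hend; simp at hend
  obtain ⟨c, K, hch, -, hds, hpred1, hpred0⟩ := se_active_rail ι V hadm h hst hflat ht hact
  rw [hds] at hend
  obtain ⟨hcV, hcK, -⟩ := se_rail_local hch
  obtain ⟨f1, f2, f3⟩ := s17_st5_fin4 K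
  by_cases hj : (st (t + 1)).level = (st t).level + 2 ∨ (st t).level = (st (t + 1)).level + 2
  · -- a JUMP at `(c, K)`
    rw [se_endsAt_jump _ _ _ hj] at hend
    simp only [List.mem_cons, Prod.mk.injEq, List.not_mem_nil, or_false] at hend
    rcases hend with ⟨hb, -⟩ | ⟨hb, -⟩
    · -- `b = (c, K + 3)`, the finish: `c + dir K` is neither in `V` nor a ghost
      subst hb
      obtain ⟨hw0, hw1⟩ := (se_active_delta ι V hst ht hact).2.1 hj
      have hng : c + dir K ∉ (ι.model V).ghosts := fun hg => by
        rcases tc_railGhost_wired ι V hadm h hst ht hch hds hpred1 hpred0 hflat hchart hg with hw | hw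
        · rw [hw0] at hw; exact Bool.false_ne_true hw
        · rw [hw1] at hw; exact Bool.false_ne_true hw
      have hnv : c + dir K ∉ (ι.model V).vertexCells := fun hv => by
        rcases Finset.mem_union.1 hv with hv | hv
        exacts [hcK hv, hng hv]
      refine ⟨(toSite (c + dir K), K + 2), fun htr' => hnv (by simpa using htr'.1), Or.inr ?_, ?_⟩
      · -- its face is the collar face before the dart, a face at `c ∈ V`
        rw [← (se_gapFace_eq_cFace c K).2.2.2]
        change gapFace (c - dir (K + 1), K) ∈ SixVertex.faces V
        rw [SixVertex.faces, Finset.mem_biUnion]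
        exact ⟨c, hcV, (se_gapFace_mem_vertexFaces c K).2.1⟩
      · rw [se_toSite_add_dir, s17_st5_cpos_add]
        simp only [f1]
    · -- `b = (c, K)`, the start: its target is live, not a cut
      subst hb
      exfalso
      refine hcut.1 ((se_targetsLive_iff _ c K).2 ⟨hcV, ?_⟩)
      have := (hch 1 0 (by norm_num) (by norm_num) (by norm_num) (by norm_num)).2 le_rfl
      simp only [one_smul, zero_smul, add_zero] at this
      exact this
  · -- a JUNCTION at `(c, K)`
    rw [se_endsAt_junction _ _ _ hact hj] at hend
    cases hw0 : (st t).wired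
    · -- free before, wired after: the junction OPENS the arc; `b = (g, K + 2)` at the ghost `g`
      rw [hw0] at hend
      simp only [Bool.false_eq_true, if_false, List.mem_cons, Prod.mk.injEq, List.not_mem_nil, or_false] at hend
      obtain ⟨hb, -⟩ := hend
      subst hb
      have hw1 : (st (t + 1)).wired = true := by
        have := (se_active_delta ι V hst ht hact).2.2 hj
        rw [hw0] at this; simpa using this
      obtain ⟨-, hg⟩ := se_arc_and_ghost ι V h hst ht hch hds (Or.inr hw1)
      refine ⟨(toSite (c + dir K), K + 3), fun htr' => (se_ghost_outer_faces ι V hch).2 htr'.2, Or.inl ?_, ?_⟩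
      · show ofSite (toSite (c + dir K)) ∈ (ι.model V).vertexCells
        rw [ofSite_toSite]
        exact Finset.mem_union_right _ hg
      · simp only [dartTip, f2]
    · -- wired before: `b = (g, K + 1)` targets the spoke `{g, c}`, which is open
      rw [hw0] at hend
      simp only [if_true, List.mem_cons, Prod.mk.injEq, List.not_mem_nil, or_false] at hend
      obtain ⟨hb, -⟩ := hend
      subst hb
      exfalso
      apply hcl
      obtain ⟨harcV, -⟩ := se_arc_and_ghost ι V h hst ht hch hds (Or.inl hw0)
      obtain ⟨e, hc, hend'⟩ := se_corner_edge (c + dir K) (K + 1)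
      have hKK : c + dir K + dir (K + 1 + 1) = c := by rw [f3, tp_dir_add_two]; abel
      rw [hKK] at hend'
      change cTgt (toSite (c + dir K), K + 1) ∈ (ι.model V).cfgOf ∅
      rw [se_cTgt_mem_cfgOf_iff _ _ hc]
      exact Or.inr (tc_spoke_open _ harcV hcK hend'.symm).2

end Summit.CriticalPhenomena.CardyFormulaZ2.Cruxes.BoundaryDefectGaussianR.RainbowMonomialsInExcursionKernels
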